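import Summits.RiemannHypothesis.RiemannHypothesis.Theorems.ScrewManifestCertTopBlock
import Summits.RiemannHypothesis.RiemannHypothesis.Theorems.IntegerScrewRungCertSound

/-!
# ScrewManifestCertResidual — part of the integer-screw manifest-certificate development

Batch 3B, second part (the floor from a top-block dual, `TopBlockD16Works`, gluing, the residual
range is one cell), Batch 3D (the `M = 8` dual of record `y8K`, `y8_inDDDual`) and the first part of
Batch 3E (the two-sided bound on `ζ(2,¼)`, the checker `dual8Check` and its kernel run).
(Split of `ScrewManifestCert.lean` v1.5 for the Theorems line cap; overview and file layout in
`Summits.RiemannHypothesis.RiemannHypothesis.Theorems.ScrewManifestCertDefs`.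
Nothing in this file bears on the truth of RH.)
-/

set_option linter.dupNamespace false
set_option autoImplicit false

namespace Summit.RiemannHypothesis.RiemannHypothesis.Theorems.IntegerScrew.Manifest

open Literature.NumberTheory.LFunctions Matrix

section Batch3B

open Finset

/-- PROVED: the top-block dual from `N₀` gives the linear floor `T > θ(1 − s/N₀)·M` for all `M ≥ N₀`. -/
theorem nyquistFloorFrom_of_topBlock {N0 : ℕ} {θ s : ℝ} (hN0 : 17 ≤ N0) (hθ : 0 ≤ θ) (hs : 0 ≤ s)
    (hdd : TopBlockDDStar) (hneg : TopBlockPairingNeg N0) (hpos : TopBlockWavePos θ s N0) :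
    NyquistFloorFrom N0 (θ * (1 - s / N0)) := by
  intro n tmin T hn htmin hcert
  by_contra hlt
  rw [not_le] at hlt
  have hN0pos : (0 : ℝ) < N0 := by exact_mod_cast (show 0 < N0 by omega)
  have hn' : (N0 : ℝ) ≤ n + 1 := by exact_mod_cast hn
  have hq : 0 ≤ s / N0 := div_nonneg hs hN0pos.le
  have hsN : s / N0 * (N0 : ℝ) = s := by field_simp
  have hmul : s / N0 * (N0 : ℝ) ≤ s / N0 * ((n : ℝ) + 1) := mul_le_mul_of_nonneg_left hn' hq
  have h1 : (1 - s / N0) * ((n : ℝ) + 1) ≤ (n : ℝ) + 1 - s := by nlinarith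
  have key : θ * (1 - s / N0) * (n + 1) ≤ θ * ((n : ℝ) + 1 - s) := by
    calc θ * (1 - s / N0) * (n + 1) = θ * ((1 - s / N0) * ((n : ℝ) + 1)) := by ring
      _ ≤ θ * ((n : ℝ) + 1 - s) := mul_le_mul_of_nonneg_left h1 hθ
  exact topBlock_noCert hN0 hdd hneg hpos n tmin T hn htmin (le_trans hlt.le key) hcert

/-- A top-block dual (block check `(DD*)`, negative pairing from `N₀`, wave positivity up to
`θ (N − s)`) gives an eventual Nyquist floor with constant `θ (1 − s/N₀)`. -/
theorem nyquistFloorEventually_of_topBlock {N0 : ℕ} {θ s : ℝ} (hN0 : 17 ≤ N0) (hθ : 0 < θ)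
    (hs : 0 ≤ s) (hsN : s < N0)
    (hdd : TopBlockDDStar) (hneg : TopBlockPairingNeg N0) (hpos : TopBlockWavePos θ s N0) :
    NyquistFloorEventually := by
  have hN0pos : (0 : ℝ) < N0 := by exact_mod_cast (show 0 < N0 by omega)
  refine ⟨θ * (1 - s / N0), mul_pos hθ ?_, N0, nyquistFloorFrom_of_topBlock hN0 hθ.le hs hdd hneg hpos⟩
  rw [sub_pos, div_lt_one hN0pos]
  exact hsN

/-- THE TYPED FIRST LEMMA of the `NyquistFloor` line (OPEN; RH-free; prime-free; two explicit
inequality families in elementary functions and the prime-free closed form of `Ψ` on `[0, log 2)`;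
FLOAT-CERT numerically as documented in the batch docstring): the design of record `D16` pairs
negatively with `S_N` and non-negatively with every wave atom `A_t`, `0 < t ≤ 0.42 (N − 8)`, for all
`N ≥ 31`.  (The third ingredient, `D16 ∈ DD*`, is `topBlockDDStar_holds`, PROVED.) -/
def TopBlockD16Works : Prop :=
  TopBlockPairingNeg 31 ∧ TopBlockWavePos (21 / 50) 8 31

/-- PROVED: the first lemma gives the linear Nyquist floor `T ≥ (21/50)(23/31)·M = 0.3116…·M` for every
manifest certificate of `S_M`, `M ≥ 31`, any `t_min > 0`. -/
theorem nyquistFloorFrom_of_D16 (h : TopBlockD16Works) :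
    NyquistFloorFrom 31 (21 / 50 * (1 - 8 / 31)) := by
  obtain ⟨hneg, hpos⟩ := h
  have := nyquistFloorFrom_of_topBlock (N0 := 31) (θ := 21 / 50) (s := 8)
    (by norm_num) (by norm_num) (by norm_num) topBlockDDStar_holds hneg hpos
  simpa using this

/-- `TopBlockD16Works` gives the eventual Nyquist floor (with `topBlockDDStar_holds`). -/
theorem nyquistFloorEventually_of_D16 (h : TopBlockD16Works) : NyquistFloorEventually :=
  ⟨21 / 50 * (1 - 8 / 31), by norm_num, 31, nyquistFloorFrom_of_D16 h⟩

/-- RESIDUAL FINITE ITEM (RH-free; a finite family of semi-infinite LPs): SOME positive floor on the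
finite range `8 ≤ M < N₀`.  For `N₀ = 31` this needs tmin-free duals for `M = 8 … 30`; `M = 8` admits
no signed-Laplacian dual (gen16 `smallM.py`), so general `DD*` duals are required — successor work.
(The census scans are consistent with `T_DD(M) ≥ 2.5·M` there, FLOAT.) -/
def SmallRangeFloor (N0 : ℕ) (c : ℝ) : Prop :=
  ∀ (n : ℕ) (tmin T : ℝ), 8 ≤ n + 1 → n + 1 < N0 → 0 < tmin → ManifestCert n tmin T → c * (n + 1) ≤ T

/-- PROVED GLUING: an eventual floor from `N₀` and any floor below `N₀` give `NyquistFloor`. -/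
theorem nyquistFloor_of_from {N0 : ℕ} {c c' : ℝ} (hc : 0 < c) (hc' : 0 < c')
    (hbig : NyquistFloorFrom N0 c) (hsmall : SmallRangeFloor N0 c') : NyquistFloor := by
  rw [nyquistFloor_iff]
  refine ⟨min c c', lt_min hc hc', fun n tmin T hn ht hm => ?_⟩
  have hpos : (0 : ℝ) ≤ n + 1 := by positivity
  by_cases h : N0 ≤ n + 1
  · exact le_trans (mul_le_mul_of_nonneg_right (min_le_left _ _) hpos) (hbig n tmin T h ht hm)
  · exact le_trans (mul_le_mul_of_nonneg_right (min_le_right _ _) hpos)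
      (hsmall n tmin T hn (by omega) ht hm)

/-- PROVED: `NyquistFloor` from the D16 first lemma plus the finite residual range `8 ≤ M ≤ 30`. -/
theorem nyquistFloor_of_D16 {c' : ℝ} (hc' : 0 < c') (h : TopBlockD16Works)
    (hsmall : SmallRangeFloor 31 c') : NyquistFloor :=
  nyquistFloor_of_from (by norm_num) hc' (nyquistFloorFrom_of_D16 h) hsmall


/-! ### The finite residual range is ONE cell (gen16): nestedness + a tmin-free dual at `M = 8` -/

/-- RH-FREE, ONE finite certificate (a 7×7 rational `DD*` matrix `Y` with `t²⟨A_t, Y⟩ ≥ 0` on ALL of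
`(0, T₈]`, `⟨J, Y⟩ ≥ 0`, `⟨S_8, Y⟩ < 0`): no manifest certificate of `S_8` at height `T₈`, for ANY
`t_min > 0`.  Census: ddcone cell `M008-T20-dd` (sos-dualcert/v1, EXACT + interval-verified on
`[1/10, 20]`) gives `T₈ = 20`; its extension to `(0, 1/10]` holds with room to spare
(`q(t) = ⟨A_t, Y⟩ ≥ 0.295` there, `q(0+) = xᵀYx = 0.2968`; gen16 `tminfree.py`, FLOAT-CERT) — so
`FloorAtEight 20` is a kernel-importable finite fact (successor work: rational `Y` + grid bound). -/
def FloorAtEight (T8 : ℝ) : Prop := ∀ tmin : ℝ, 0 < tmin → ¬ ManifestCert 7 tmin T8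

/-- PROVED: a floor at `M = 8` is a floor at EVERY `M ≥ 8` (nestedness `manifestCertNested_proof` +
window monotonicity `manifestCert_mono`): `T_DD(M) > T₈` for all `M ≥ 8`, RH-free, from ONE 7×7 dual. -/
theorem constFloor_of_eight {T8 : ℝ} (h8 : FloorAtEight T8) (n : ℕ) (hn : 7 ≤ n) (tmin T : ℝ)
    (htmin : 0 < tmin) (hT : T ≤ T8) : ¬ ManifestCert n tmin T := fun hcert =>
  h8 tmin htmin (manifestCert_mono le_rfl hT (manifestCertNested_proof n 7 tmin T hn hcert))

/-- PROVED: hence the finite range `8 ≤ M < N₀` carries the linear floor `c·M` for any `c ≥ 0` with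
`c (N₀ − 1) ≤ T₈`. -/
theorem smallRangeFloor_of_eight {T8 c : ℝ} {N0 : ℕ} (hc : 0 ≤ c) (hcT : c * ((N0 : ℝ) - 1) ≤ T8)
    (h8 : FloorAtEight T8) : SmallRangeFloor N0 c := by
  intro n tmin T hn hlt htmin hcert
  have hT : T8 < T := by
    by_contra hle
    rw [not_lt] at hle
    exact constFloor_of_eight h8 n (by omega) tmin T htmin hle hcert
  have hN : ((n : ℝ) + 1) ≤ (N0 : ℝ) - 1 := by
    have h2 : ((n + 2 : ℕ) : ℝ) ≤ (N0 : ℝ) := by exact_mod_cast (show n + 2 ≤ N0 by omega)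
    push_cast at h2
    linarith
  calc c * (n + 1) ≤ c * ((N0 : ℝ) - 1) := mul_le_mul_of_nonneg_left hN hc
    _ ≤ T8 := hcT
    _ ≤ T := hT.le

/-- PROVED (gen16 bottom line): `NyquistFloor` ⟸ the `D16` first lemma (`TopBlockD16Works`: two
explicit RH-free, prime-free inequality families, all `N ≥ 31`) ∧ ONE tmin-free dual certificate at
`M = 8` (`FloorAtEight T₈`, `T₈ > 0`; census: `T₈ = 20`).  Constant obtained: `min(0.3116, T₈/30)`. -/
theorem nyquistFloor_of_D16_and_eight {T8 : ℝ} (hT8 : 0 < T8) (h : TopBlockD16Works)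
    (h8 : FloorAtEight T8) : NyquistFloor :=
  nyquistFloor_of_D16 (c' := T8 / 30) (by positivity) h
    (smallRangeFloor_of_eight (by positivity)
      (by
        have e : T8 / 30 * (((31 : ℕ) : ℝ) - 1) = T8 := by push_cast; ring
        exact e.le)
      h8)

end Batch3B

/-! ## Batch 3D (gen16) — the `M = 8` dual of record, typed exactly

The residual hypothesis `FloorAtEight T₈` of `nyquistFloor_of_D16_and_eight` is discharged by ONE dual
certificate at `M = 8`.  The census cell `M008-T20-dd` (engine B, rh-explicit-sos-eng-2 gen2, schema
`sos-dualcert/v1`, file `pub/rh-explicit/sos/census/engine-B/ddcone/cells/M008-T20-dd/dualcert.json`,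
EXACT+IV certified on the band `[1/10, 20]`) provides a rational `Y` (eight row-pattern weights + `ε·I`,
`ε = 2748779/2^38`); `y8K = 2^41·Y` below is that matrix as INTEGERS (the certificate is scale-free).
PROVED here (kernel): `Y ∈ DD*` (`y8_inDDDual`, `decide +kernel`; the off-diagonal slack is exactly
`2^41 ε`) and `⟨J, Y⟩ ≥ 0` (`frob_ones_y8`; `Σ_ij Y_ij = 19241453/2^38 > 0`), hence
`floorAtEight_of_dual8 : Dual8PairingNeg → Dual8WavePos T₈ → FloorAtEight T₈` and the bottom line
`nyquistFloor_of_D16_and_dual8 : TopBlockD16Works → Dual8PairingNeg → Dual8WavePos 20 → NyquistFloor`.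
Typed, both FINITE statements about explicit numbers, BOTH NOW PROVED IN THE KERNEL (Batches 3E, 3F):
`Dual8PairingNeg` (`⟨S_8, Y⟩ < 0`, PROVED in Batch 3E; engine B:
`⟨S_8, Y⟩/2^41 = −0.009795` with a 128-bit interval box for `S_8` — kernel import = the tree's `RungCert`
enclosure engine for the 28 entries of `S_8`, both bounds on `ζ(2,¼)`) and `Dual8WavePos 20`
(`Q(t) := t²⟨A_t, Y⟩ ≥ 0` on `(0, 20]`; engine B EXACT+IV on `[1/10, 20]`: grid `h = 5·10⁻⁴`, 39 801 points,
`|Q″| ≤ 14.2/2^41·…`, `min Q = 1.13·10⁻⁴·2^41` at the ACTIVE ATOMS `t ≈ 2.43, 6.54, 14.28` of the primal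
(complementary slackness: the margin there is only `ε`-induced, so a kernel grid needs `h ≈ 3·10⁻³` near them);
gen16 FLOAT-CERT on `(0, 1/10]`: `Q(t)/t² ≥ 0.2954·2^41`, `q(0⁺) = xᵀYx`; PROVED in Batch 3F by a second-order adaptive
kernel certificate).  Nothing here bears on RH. -/

section Batch3D

/-- `2^41 · Y` for the census dual certificate `M008-T20-dd` (rows/columns = nodes `log 2, …, log 8`). -/
def y8K : Fin 7 → Fin 7 → ℤ :=
  ![![306536900498, 388589108770, -489155891066, -153257455133, 173094602860, -158175142535,
      153257455133],
    ![388589108770, 470685297506, -921499337514, 50540312777, 255168801364, -240249341039,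
      -235331653637],
    ![-489155891066, -921499337514, 1372357357986, -686167683877, 706004831604, -691085371279,
      684326005213],
    ![-153257455133, 50540312777, -686167683877, 21990232, 19837147727, -4917687402, 0],
    ![173094602860, 255168801364, 706004831604, 19837147727, 39696285686, 24754835129, 19837147727],
    ![-158175142535, -240249341039, -691085371279, -4917687402, 24754835129, 9857365036, 4917687402],
    ![153257455133, -235331653637, 684326005213, 0, 19837147727, 4917687402, 21990232]]

/-- The `M = 8` dual of record as a real matrix. -/
def y8 : Matrix (Fin 7) (Fin 7) ℝ := Matrix.of fun i j => (y8K i j : ℝ)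

/-- KERNEL CHECK: `2^41·Y ∈ DD*` over `ℤ`. -/
theorem y8K_dd :
    (∀ i : Fin 7, 0 ≤ y8K i i) ∧ ∀ i j : Fin 7, i ≠ j → 2 * |y8K i j| ≤ y8K i i + y8K j j := by
  decide +kernel

/-- PROVED: the `M = 8` dual of record lies in `DD*`. -/
theorem y8_inDDDual : InDDDual y8 := by
  refine ⟨fun i => ?_, fun i j hij => ?_⟩
  · simp only [y8, Matrix.of_apply]; exact_mod_cast y8K_dd.1 i
  · simp only [y8, Matrix.of_apply]; exact_mod_cast y8K_dd.2 i j hij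

/-- KERNEL CHECK: `Σ_ij (2^41 Y)_ij > 0`. -/
theorem y8K_sum_pos : 0 < ∑ i : Fin 7, ∑ j : Fin 7, y8K i j := by decide +kernel

/-- PROVED: `⟨J, Y⟩ ≥ 0` for the `M = 8` dual of record. -/
theorem frob_ones_y8 : 0 ≤ frob (onesMat 7) y8 := by
  have h : frob (onesMat 7) y8 = ((∑ i : Fin 7, ∑ j : Fin 7, y8K i j : ℤ) : ℝ) := by
    simp only [frob, onesMat, y8, Matrix.of_apply, one_mul, Int.cast_sum]
  rw [h]
  exact_mod_cast y8K_sum_pos.le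

/-- PROVED IN THE KERNEL (Batch 3E below, `dual8PairingNeg_holds`): the `M = 8` dual pairs negatively
with `S_8`, `⟨S_8, Y⟩ < 0` (engine B: `= −0.009795·2^41`; kernel: `RungCert` enclosures of the 28
entries + a two-sided bound on `ζ(2,¼)`, `decide +kernel`). -/
def Dual8PairingNeg : Prop := frob (screwMatrix 7) y8 < 0

/-- PROVED IN THE KERNEL for `T₈ = 20` (Batch 3F below, `dual8WavePos_holds`; before that: engine B
EXACT+IV on `[1/10, 20]`, gen16 FLOAT-CERT on `(0, 1/10]`): wave positivity of the `M = 8` dual on the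
whole band `(0, T₈]`.  The delicate points are the primal's active atoms `t ≈ 2.43, 6.54, 14.28`, where
the margin is only the `ε`-slack (`Q ≈ 1.1·10⁻⁴` vs `max Q ≈ 6` in units of `2^{-41}`); the kernel
certificate's adaptive cells shrink to `10/1024` there. -/
def Dual8WavePos (T8 : ℝ) : Prop := ∀ t : ℝ, 0 < t → t ≤ T8 → 0 ≤ frob (waveAtom 7 t) y8

/-- PROVED REDUCTION: the two finite facts about the `M = 8` dual give `FloorAtEight` (any `t_min > 0`). -/
theorem floorAtEight_of_dual8 {T8 : ℝ} (hneg : Dual8PairingNeg) (hpos : Dual8WavePos T8) :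
    FloorAtEight T8 := fun _ htmin =>
  dualCert_sound ⟨y8_inDDDual, fun t ht1 ht2 => hpos t (lt_of_lt_of_le htmin ht1) ht2, frob_ones_y8, hneg⟩

/-- PROVED (gen16 bottom line, fully explicit form): `NyquistFloor` follows from three OPEN statements
about EXPLICIT NUMBERS ONLY — the `D16` first lemma (two inequality families, all `N ≥ 31`) and the two
finite facts about the `M = 8` dual of record — all RH-free, the first prime-free. -/
theorem nyquistFloor_of_D16_and_dual8 (h : TopBlockD16Works) (hneg : Dual8PairingNeg)
    (hpos : Dual8WavePos 20) : NyquistFloor :=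
  nyquistFloor_of_D16_and_eight (by norm_num) h (floorAtEight_of_dual8 hneg hpos)

end Batch3D

/-! ## Batch 3E (gen16) — `Dual8PairingNeg` PROVED in the kernel

The pairing leaf `⟨S_8, Y⟩ < 0` of Batch 3D is discharged UNCONDITIONALLY with the tree's validated
fixed-point interval engine (`Literature.Analysis.ValidatedNumerics`, scale `2^48`) and the enclosure
tables of `IntegerScrewRungCert{Defs,Series,Sound}` (rh-explicit-sos-eng-1): `S_8 = T(C)` with
`C = ζ(2,¼)` (`screwMatrix_eq_tMat`), `T(C) = T(c_lo) + ((C − c_lo)/4)(I + J)` (`tMat_split`), the 28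
entries of `T(c_lo)` enclosed by `tEncl (uTable (logTable 8) A 7)` (`mem_tEncl`, `mem_uEncl`), and a NEW
two-sided bound `c_lo ≤ C ≤ c_hi` (`lerchC_le_cHiQ`: telescoping `Σ_{k ≥ K}(k+¼)^{-2} ≤ 1/(K − ¾)`, needed
because `⟨I + J, Y⟩ = tr Y + Σ Y > 0`).  The Boolean `dual8Check` (log table valid ∧ slope enclosure
found ∧ `4·ZB + 2^48·(c_hi − c_lo)·P8 < 0` in `ℚ`, where `ZB = Σ_ij (hi_ij or lo_ij by the sign of
Y_ij)·(2^41 Y)_ij` and `P8 = tr + Σ` of `2^41 Y`) evaluates to `true` by `decide +kernel`, and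
`dual8PairingNeg_holds : Dual8PairingNeg` follows (standard axioms).  Consequently
`nyquistFloor_of_D16_and_wave8 : TopBlockD16Works → Dual8WavePos 20 → NyquistFloor` (and, with Batch 3F's
`dual8WavePos_holds`, `nyquistFloor_of_D16' : TopBlockD16Works → NyquistFloor`).  Nothing here bears on RH. -/

section Batch3E

open Literature.Analysis.ValidatedNumerics Literature.Analysis.ValidatedNumerics.Numerics Finset

/-- Telescoping UPPER bound of the tail: `Σ_{K ≤ k < K'} (k+¼)^{-2} ≤ 1/(K − ¾) − 1/(K' − ¾)` (`1 ≤ K`). -/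
theorem sum_Ico_quarter_sq_le {K : ℕ} (hK : 1 ≤ K) : ∀ K' : ℕ, K ≤ K' →
    ∑ k ∈ Finset.Ico K K', 1 / ((k : ℝ) + 1 / 4) ^ 2 ≤ 1 / ((K : ℝ) - 3 / 4) - 1 / ((K' : ℝ) - 3 / 4)
  | 0, h => by omega
  | K' + 1, h => by
    rcases Nat.lt_or_ge K (K' + 1) with hlt | hge
    · rw [Finset.sum_Ico_succ_top (by omega)]
      have ih := sum_Ico_quarter_sq_le hK K' (by omega)
      have hK'1 : (1 : ℝ) ≤ K' := by exact_mod_cast (show 1 ≤ K' by omega)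
      have h1 : (0 : ℝ) < (K' : ℝ) - 3 / 4 := by linarith
      have h2 : (0 : ℝ) < (K' : ℝ) + 1 - 3 / 4 := by linarith
      have hstep : 1 / ((K' : ℝ) + 1 / 4) ^ 2 ≤
          1 / ((K' : ℝ) - 3 / 4) - 1 / (((K' + 1 : ℕ) : ℝ) - 3 / 4) := by
        push_cast
        rw [div_sub_div _ _ h1.ne' h2.ne', div_le_div_iff₀ (by positivity) (mul_pos h1 h2)]
        nlinarith
      push_cast at hstep ⊢
      linarith
    · have : K = K' + 1 := le_antisymm h hge
      subst this; simp

/-- `c_hi := (Σ_{k<300}(k+¼)^{-2})^+ + 1/(300 − ¾)` (upper companion of `RungCert.cLoQ`). -/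
def cHiQ : ℚ := ((RungCert.cPartial RungCert.cTerms).hi : ℚ) / SC + 4 / (4 * RungCert.cTerms - 3)

/-- **Upper bound of `C = ζ(2,¼)`**: `C ≤ c_hi`. -/
theorem lerchC_le_cHiQ : RungCert.lerchC ≤ ((cHiQ : ℚ) : ℝ) := by
  have hS : (0 : ℝ) < SC := SC_pos
  have h1 := (RungCert.mem_cPartial RungCert.cTerms).2
  have hpart : ∑ k ∈ range RungCert.cTerms, 1 / ((k : ℝ) + 1 / 4) ^ 2 ≤
      (((RungCert.cPartial RungCert.cTerms).hi : ℤ) : ℝ) / SC := by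
    rw [le_div_iff₀ hS]; exact h1
  have hT : (RungCert.cTerms : ℝ) = 300 := by norm_num [RungCert.cTerms]
  have htail : ∀ n, ∑ i ∈ range n, 1 / ((i : ℝ) + 1 / 4) ^ 2 ≤
      ∑ k ∈ range RungCert.cTerms, 1 / ((k : ℝ) + 1 / 4) ^ 2 + 1 / ((RungCert.cTerms : ℝ) - 3 / 4) := by
    intro n
    rcases le_or_gt n RungCert.cTerms with hn | hn
    · have hsub : ∑ i ∈ range n, 1 / ((i : ℝ) + 1 / 4) ^ 2 ≤
          ∑ k ∈ range RungCert.cTerms, 1 / ((k : ℝ) + 1 / 4) ^ 2 :=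
        Finset.sum_le_sum_of_subset_of_nonneg (Finset.range_mono hn) fun k _ _ =>
          one_div_nonneg.2 (sq_nonneg _)
      have hpos : (0 : ℝ) < 1 / ((RungCert.cTerms : ℝ) - 3 / 4) := by rw [hT]; norm_num
      linarith
    · rw [range_eq_Ico, ← Finset.sum_Ico_consecutive _ (Nat.zero_le RungCert.cTerms) hn.le, ← range_eq_Ico]
      have h2 := sum_Ico_quarter_sq_le (K := RungCert.cTerms) (by norm_num [RungCert.cTerms]) n hn.le
      have hn' : (300 : ℝ) < n := by rw [← hT]; exact_mod_cast hn
      have hpos : (0 : ℝ) < 1 / ((n : ℝ) - 3 / 4) := by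
        apply div_pos one_pos; linarith
      linarith
  have hsum := Real.tsum_le_of_sum_range_le (f := fun k : ℕ => 1 / ((k : ℝ) + 1 / 4) ^ 2)
    (fun n => one_div_nonneg.2 (sq_nonneg _)) htail
  have h5 : (((4 / (4 * RungCert.cTerms - 3) : ℚ)) : ℝ) = 1 / ((RungCert.cTerms : ℝ) - 3 / 4) := by
    push_cast
    rw [hT, div_eq_div_iff (by norm_num) (by norm_num)]; ring
  unfold RungCert.lerchC
  unfold cHiQ
  push_cast at h5 ⊢
  rw [h5]
  linarith

/-- Signed upper-bound table: `hi_ij·(2^41 Y)_ij` if `Y_ij ≥ 0`, else `lo_ij·(2^41 Y)_ij`. -/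
def zb (utab : List (List FI)) (i j : Fin 7) : ℤ :=
  if 0 ≤ y8K i j then (RungCert.tEncl utab i j).hi * y8K i j
  else (RungCert.tEncl utab i j).lo * y8K i j

/-- `ZB = Σ_ij zb_ij` — `2^48 · 2^41 ·` an upper bound of `⟨T(c_lo), Y⟩`. -/
def ZB (utab : List (List FI)) : ℤ := ∑ i : Fin 7, ∑ j : Fin 7, zb utab i j

/-- `P8 = tr(2^41 Y) + Σ_ij (2^41 Y)_ij = 2^41 ⟨I + J, Y⟩`. -/
def P8 : ℤ := ∑ i : Fin 7, y8K i i + ∑ i : Fin 7, ∑ j : Fin 7, y8K i j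

/-- The logarithm table `log 0, …, log 8` (scale `2^48`). -/
def logs8 : List FI := FI.logTable 8

/-- The Boolean certificate checker for `Dual8PairingNeg`. -/
def dual8Check : Bool :=
  FI.logTableOK 8 &&
    match RungCert.slopeEncl logs8 with
    | none => false
    | some A => decide ((4 : ℚ) * ZB (RungCert.uTable logs8 A 7) +
        (SC : ℚ) * (cHiQ - RungCert.cLoQ) * P8 < 0)

set_option maxRecDepth 200000 in
/-- KERNEL COMPUTATION: the checker passes. -/
theorem dual8Check_eq_true : dual8Check = true := by
  decide +kernel

/-- KERNEL COMPUTATION: `⟨I + J, 2^41 Y⟩ ≥ 0`. -/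
theorem P8_nonneg : 0 ≤ P8 := by
  decide +kernel


end Batch3E

end Summit.RiemannHypothesis.RiemannHypothesis.Theorems.IntegerScrew.Manifest
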